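import Literature.MathematicalPhysics.QuantumManyBody.GroundState
import Literature.Analysis.FunctionSpaces.SobolevDomainProofs
import Literature.MathematicalPhysics.QuantumManyBody.BoseGasProductState
import Literature.MathematicalPhysics.QuantumManyBody.GroundStateFeynmanKacCompact
import HarnessLib

/-!
# Route `BECCutLineWeakDisorder`, crux `GroundStateRigidity` (stmt-AtomisticToContinuum-9072),
# line `Sketch`: the registered stub `stub_compactness`

Supports (does not close) stmt-AtomisticToContinuum-9072. **Compactness of bounded-energy sequences
of trial states** (Rellich–Kondrachov on the box; Reed–Simon IV, Thm XIII.64, compact resolvent of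
the Dirichlet problem on a bounded region): for EVERY pair potential `v`, every sequence
`Φ : ℕ → TrialState N L` with `energy v (Φ n) ≤ E < ⊤` has a subsequence converging in
`L²((ℝ³)^N)` to a Borel measurable, Dirichlet (zero off the open box `Λ_L^N`), Bose-symmetric
function `Ψ`.

## Proof

1. `∫ |∇Φₙ|² ≤ energy v Φₙ ≤ E` (drop the interaction), and pointwise
   `‖DΦₙ(X)‖² ≤ 3N · |∇Φₙ(X)|²` (`nnnorm_sq_le_mul_sum_sq`: decompose a configuration-space vector in
   the basis `e_{ik} = Pi.single i (EuclideanSpace.single k 1)`, its coefficients are bounded by the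
   sup-of-Euclidean norm, then Cauchy–Schwarz on the finite sum), so
   `‖DΦₙ‖_{L²} ≤ (3N E)^{1/2}` uniformly (`eLpNorm_fderiv_le`); `‖Φₙ‖_{L²} = 1`; the supports lie in
   the compact closure of the bounded box (`isBounded_boxN`).
2. The tree's `C¹` Rellich–Kondrachov core
   `Literature.Analysis.FunctionSpaces.exists_subseq_tendsto_eLpNorm_of_contDiff` (Evans, *PDE*,
   §5.7 Thm 1) yields `f ∈ L²` and a subsequence with `‖Φ_{φ n} - f‖_{L²} → 0`, i.e.
   `∫ |Φ_{φ n} - f|² → 0`.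
3. Representative (`exists_symm_limit`): replace `f` by a Borel measurable version cut off to the
   box, `f₂ = 1_{Λ^N} f̃` (still a limit, pointwise domination since each `Φₙ` vanishes off the box),
   and symmetrise, `Ψ(X) = (N!)⁻¹ ∑_σ f₂(X ∘ σ)`: measurable, Dirichlet and symmetric POINTWISE, and
   since each `Φₙ` is symmetric, `Φₙ - Ψ = (N!)⁻¹ ∑_σ (Φₙ - f₂) ∘ σ`, whence
   `∫ |Φₙ - Ψ|² ≤ C ∫ |Φₙ - f₂|² → 0` by Cauchy–Schwarz on the finite sum and permutation invariance
   of Lebesgue measure (`lintegral_comp_perm`).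
-/

noncomputable section

open MeasureTheory Filter
open scoped ENNReal NNReal Topology

namespace Summit.AtomisticToContinuum.BoseEinsteinCondensation.Theorems.GroundStateRigidity

open Literature.MathematicalPhysics.QuantumManyBody.BoseGas

variable {N : ℕ}

/-! ### The operator norm of `DΨ(X)` against the kinetic energy density -/

/-- `‖A w‖ ≤ (∑_{i,k} ‖A e_{ik}‖) ‖w‖` for a linear form `A` on configuration space `(ℝ³)^N`
(sup norm over particles of Euclidean norms) and the coordinate vectors
`e_{ik} = Pi.single i (EuclideanSpace.single k 1)`: expand `w = ∑_{i,k} w_{ik} e_{ik}` and use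
`|w_{ik}| ≤ ‖w i‖ ≤ ‖w‖`. [folklore] -/
theorem norm_clm_apply_le_sum_mul (A : Config N →L[ℝ] ℂ) (w : Config N) :
    ‖A w‖ ≤ (∑ i : Fin N, ∑ k : Fin 3, ‖A (Pi.single i (EuclideanSpace.single k (1 : ℝ)))‖) * ‖w‖ := by
  have hdec : w = ∑ i : Fin N, ∑ k : Fin 3,
      (w i k) • (Pi.single i (EuclideanSpace.single k (1 : ℝ)) : Config N) := by
    conv_lhs => rw [← Finset.univ_sum_single w]
    refine Finset.sum_congr rfl fun i _ => ?_
    have hx : w i = ∑ k : Fin 3, (w i k) • EuclideanSpace.single k (1 : ℝ) := by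
      conv_lhs => rw [← (EuclideanSpace.basisFun (Fin 3) ℝ).sum_repr (w i)]
      simp [EuclideanSpace.basisFun_apply]
    conv_lhs => rw [hx]
    rw [← LinearMap.coe_single (R := ℝ), map_sum]
    simp only [map_smul, LinearMap.coe_single]
  calc ‖A w‖ = ‖∑ i : Fin N, ∑ k : Fin 3,
        (w i k) • A (Pi.single i (EuclideanSpace.single k (1 : ℝ)))‖ := by
        conv_lhs => rw [hdec]
        simp only [map_sum, map_smul]
    _ ≤ ∑ i : Fin N, ∑ k : Fin 3, ‖(w i k) • A (Pi.single i (EuclideanSpace.single k (1 : ℝ)))‖ :=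
        (norm_sum_le _ _).trans (Finset.sum_le_sum fun i _ => norm_sum_le _ _)
    _ ≤ ∑ i : Fin N, ∑ k : Fin 3, ‖A (Pi.single i (EuclideanSpace.single k (1 : ℝ)))‖ * ‖w‖ := by
        refine Finset.sum_le_sum fun i _ => Finset.sum_le_sum fun k _ => ?_
        rw [norm_smul, mul_comm]
        exact mul_le_mul_of_nonneg_left ((PiLp.norm_apply_le (w i) k).trans (norm_le_pi_norm w i))
          (norm_nonneg _)
    _ = (∑ i : Fin N, ∑ k : Fin 3, ‖A (Pi.single i (EuclideanSpace.single k (1 : ℝ)))‖) * ‖w‖ := by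
        rw [Finset.sum_mul]
        exact Finset.sum_congr rfl fun i _ => (Finset.sum_mul _ _ _).symm

/-- `‖A‖² ≤ 3N · ∑_{i,k} ‖A e_{ik}‖²` in `ℝ≥0∞` for a linear form `A` on `(ℝ³)^N`: the operator
norm is at most `∑_{i,k} ‖A e_{ik}‖` (`norm_clm_apply_le_sum_mul`), and Cauchy–Schwarz on the
`3N` terms. [folklore] -/
theorem nnnorm_sq_le_mul_sum_sq (A : Config N →L[ℝ] ℂ) :
    ((‖A‖₊ : ℝ≥0∞)) ^ 2 ≤ (3 * N : ℝ≥0∞) *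
      ∑ i : Fin N, ∑ k : Fin 3, ((‖A (Pi.single i (EuclideanSpace.single k (1 : ℝ)))‖₊ : ℝ≥0∞)) ^ 2 := by
  have h1 : ‖A‖₊ ≤ ∑ i : Fin N, ∑ k : Fin 3, ‖A (Pi.single i (EuclideanSpace.single k (1 : ℝ)))‖₊ := by
    have h := ContinuousLinearMap.opNorm_le_bound A (by positivity) (norm_clm_apply_le_sum_mul A)
    exact NNReal.coe_le_coe.1 (by simpa using h)
  have h2 : (∑ i : Fin N, ∑ k : Fin 3, ‖A (Pi.single i (EuclideanSpace.single k (1 : ℝ)))‖₊) ^ 2 ≤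
      (3 * N : ℝ≥0) *
        ∑ i : Fin N, ∑ k : Fin 3, ‖A (Pi.single i (EuclideanSpace.single k (1 : ℝ)))‖₊ ^ 2 := by
    calc (∑ i : Fin N, ∑ k : Fin 3, ‖A (Pi.single i (EuclideanSpace.single k (1 : ℝ)))‖₊) ^ 2
        ≤ (N : ℝ≥0) * ∑ i : Fin N,
            (∑ k : Fin 3, ‖A (Pi.single i (EuclideanSpace.single k (1 : ℝ)))‖₊) ^ 2 := by
          have h := sq_sum_le_card_mul_sum_sq (s := (Finset.univ : Finset (Fin N)))
            (f := fun i => ∑ k : Fin 3, ‖A (Pi.single i (EuclideanSpace.single k (1 : ℝ)))‖₊)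
          simpa using h
      _ ≤ (N : ℝ≥0) * ∑ i : Fin N,
            ((3 : ℝ≥0) * ∑ k : Fin 3, ‖A (Pi.single i (EuclideanSpace.single k (1 : ℝ)))‖₊ ^ 2) := by
          gcongr with i
          have h := sq_sum_le_card_mul_sum_sq (s := (Finset.univ : Finset (Fin 3)))
            (f := fun k => ‖A (Pi.single i (EuclideanSpace.single k (1 : ℝ)))‖₊)
          simpa using h
      _ = (3 * N : ℝ≥0) *
            ∑ i : Fin N, ∑ k : Fin 3, ‖A (Pi.single i (EuclideanSpace.single k (1 : ℝ)))‖₊ ^ 2 := by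
          rw [← Finset.mul_sum]
          ring
  have h3 := ENNReal.coe_le_coe.2 ((pow_le_pow_left₀ zero_le h1 2).trans h2)
  push_cast at h3
  exact h3

/-- **`‖DΨ(X)‖² ≤ 3N |∇Ψ(X)|²`**: the squared operator norm of the Fréchet derivative is at most
`3N` times the kinetic energy density `∑_{i,k} |∂_{ik}Ψ(X)|²`. [folklore] -/
theorem nnnorm_fderiv_sq_le (ψ : Config N → ℂ) (X : Config N) :
    ((‖fderiv ℝ ψ X‖₊ : ℝ≥0∞)) ^ 2 ≤ (3 * N : ℝ≥0∞) * kineticDensity ψ X :=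
  nnnorm_sq_le_mul_sum_sq (fderiv ℝ ψ X)

/-- **Uniform `W^{1,2}` bound**: a trial state of energy `≤ E` has `‖DΨ‖_{L²} ≤ (3N · E)^{1/2}`
(drop the nonnegative interaction, `nnnorm_fderiv_sq_le`). [folklore] -/
theorem eLpNorm_fderiv_le {L : ℝ} (v : ℝ → ℝ≥0∞) (Ψ : TrialState N L) {E : ℝ≥0∞}
    (hE : energy v Ψ ≤ E) :
    eLpNorm (fderiv ℝ Ψ.ψ) 2 volume ≤ ((3 * N : ℝ≥0∞) * E) ^ (1 / 2 : ℝ) := by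
  rw [eLpNorm_eq_lintegral_rpow_enorm_toReal two_ne_zero ENNReal.ofNat_ne_top, ENNReal.toReal_ofNat]
  refine ENNReal.rpow_le_rpow ?_ (by norm_num)
  have hkin : ∫⁻ X, kineticDensity Ψ.ψ X ≤ E :=
    (lintegral_mono fun X => le_self_add).trans hE
  calc ∫⁻ X, ‖fderiv ℝ Ψ.ψ X‖ₑ ^ (2 : ℝ) = ∫⁻ X, ((‖fderiv ℝ Ψ.ψ X‖₊ : ℝ≥0∞)) ^ 2 := by
        simp_rw [enorm_eq_nnnorm, ENNReal.rpow_two]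
    _ ≤ ∫⁻ X, (3 * N : ℝ≥0∞) * kineticDensity Ψ.ψ X :=
        lintegral_mono fun X => nnnorm_fderiv_sq_le _ _
    _ = (3 * N : ℝ≥0∞) * ∫⁻ X, kineticDensity Ψ.ψ X :=
        lintegral_const_mul' _ _ (ENNReal.mul_ne_top (by norm_num) (ENNReal.natCast_ne_top N))
    _ ≤ (3 * N : ℝ≥0∞) * E := by gcongr

/-! ### A measurable, Dirichlet, symmetric representative of the limit -/

/-- **Symmetric Dirichlet representative of an `L²`-limit.** If measurable functions `gₙ` on
`(ℝ³)^N`, each vanishing off the box `Λ_L^N` and symmetric under relabelling, converge in `L²` to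
`f`, then they converge in `L²` to a Borel measurable `Ψ` that vanishes off the box and is
symmetric POINTWISE: `Ψ(X) = (N!)⁻¹ ∑_σ (1_{Λ^N} f̃)(X ∘ σ)` for a measurable version `f̃` of `f`
(`∫|gₙ - Ψ|² ≤ C ∫|gₙ - 1_{Λ^N} f̃|² ≤ C ∫|gₙ - f|²` by the symmetry of `gₙ`, Cauchy–Schwarz on the
finite sum and permutation invariance of Lebesgue measure). [folklore] -/
theorem exists_symm_limit (L : ℝ) (g : ℕ → Config N → ℂ) (hgm : ∀ n, Measurable (g n))
    (hg0 : ∀ n X, X ∉ boxN N L → g n X = 0)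
    (hgσ : ∀ n (σ : Equiv.Perm (Fin N)) (X : Config N), g n (X ∘ σ) = g n X)
    {f : Config N → ℂ} (hf : AEStronglyMeasurable f volume)
    (hlim : Tendsto (fun n => ∫⁻ X, (‖g n X - f X‖₊ : ℝ≥0∞) ^ 2) atTop (𝓝 0)) :
    ∃ Ψ : Config N → ℂ, Measurable Ψ ∧ (∀ X, X ∉ boxN N L → Ψ X = 0) ∧
      (∀ (σ : Equiv.Perm (Fin N)) (X : Config N), Ψ (X ∘ σ) = Ψ X) ∧
      Tendsto (fun n => ∫⁻ X, (‖g n X - Ψ X‖₊ : ℝ≥0∞) ^ 2) atTop (𝓝 0) := by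
  -- a Borel measurable version of `f`, cut off to the box
  obtain ⟨f₂, hf₂, hf₂m, hf₂0⟩ : ∃ f₂ : Config N → ℂ, f₂ = (boxN N L).indicator (hf.mk f) ∧
      Measurable f₂ ∧ ∀ X, X ∉ boxN N L → f₂ X = 0 :=
    ⟨_, rfl, hf.stronglyMeasurable_mk.measurable.indicator (measurableSet_boxN N L),
      fun X hX => Set.indicator_of_notMem hX _⟩
  have hpt : ∀ n X, (‖g n X - f₂ X‖₊ : ℝ≥0∞) ^ 2 ≤ (‖g n X - hf.mk f X‖₊ : ℝ≥0∞) ^ 2 := by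
    intro n X
    by_cases hX : X ∈ boxN N L
    · rw [hf₂, Set.indicator_of_mem hX]
    · rw [hf₂0 X hX, hg0 n X hX]
      simp
  have hlim₂ : Tendsto (fun n => ∫⁻ X, (‖g n X - f₂ X‖₊ : ℝ≥0∞) ^ 2) atTop (𝓝 0) := by
    have heq : ∀ n, ∫⁻ X, (‖g n X - hf.mk f X‖₊ : ℝ≥0∞) ^ 2 = ∫⁻ X, (‖g n X - f X‖₊ : ℝ≥0∞) ^ 2 :=
      fun n => lintegral_congr_ae (hf.ae_eq_mk.mono fun X hX => by simp only [hX])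
    refine tendsto_of_tendsto_of_tendsto_of_le_of_le tendsto_const_nhds hlim (fun n => zero_le)
      fun n => ?_
    rw [← heq n]
    exact lintegral_mono (hpt n)
  -- measurability of relabelling
  have hperm : ∀ σ : Equiv.Perm (Fin N), Measurable fun X : Config N => X ∘ σ := fun σ => by
    fun_prop
  -- the symmetrisation
  set c : ℂ := ((Fintype.card (Equiv.Perm (Fin N)) : ℂ))⁻¹ with hc
  have hcard : c * (Fintype.card (Equiv.Perm (Fin N)) : ℂ) = 1 :=
    inv_mul_cancel₀ (Nat.cast_ne_zero.2 Fintype.card_ne_zero)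
  refine ⟨fun X => c * ∑ σ : Equiv.Perm (Fin N), f₂ (X ∘ σ), ?_, ?_, ?_, ?_⟩
  · exact (Finset.measurable_sum _ fun σ _ => hf₂m.comp (hperm σ)).const_mul c
  · intro X hX
    have h0 : ∀ σ : Equiv.Perm (Fin N), f₂ (X ∘ σ) = 0 := fun σ => by
      refine hf₂0 _ fun h => hX fun j => ?_
      have h' : ∀ i, (X ∘ σ) i ∈ box L := h
      simpa using h' (σ.symm j)
    show c * ∑ σ : Equiv.Perm (Fin N), f₂ (X ∘ σ) = 0
    rw [Finset.sum_eq_zero fun σ _ => h0 σ, mul_zero]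
  · intro τ X
    show c * ∑ σ : Equiv.Perm (Fin N), f₂ ((X ∘ τ) ∘ σ) = c * ∑ σ : Equiv.Perm (Fin N), f₂ (X ∘ σ)
    congr 1
    exact Fintype.sum_equiv (Equiv.mulLeft τ) _ _ fun σ => rfl
  · -- `∫|gₙ - Ψ|² ≤ C ∫|gₙ - f₂|² → 0`
    have hC : ((‖c‖₊ : ℝ≥0∞)) ^ 2 * (Fintype.card (Equiv.Perm (Fin N)) : ℝ≥0∞) *
        (Fintype.card (Equiv.Perm (Fin N)) : ℝ≥0∞) ≠ ⊤ := by finiteness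
    -- Cauchy–Schwarz on the finite sum over permutations, in `ℝ≥0∞`
    have hcs : ∀ a : Equiv.Perm (Fin N) → ℂ, ((‖∑ σ, a σ‖₊ : ℝ≥0∞)) ^ 2 ≤
        (Fintype.card (Equiv.Perm (Fin N)) : ℝ≥0∞) * ∑ σ, ((‖a σ‖₊ : ℝ≥0∞)) ^ 2 := by
      intro a
      have h : ‖∑ σ, a σ‖₊ ^ 2 ≤ (Fintype.card (Equiv.Perm (Fin N)) : ℝ≥0) * ∑ σ, ‖a σ‖₊ ^ 2 := by
        have h' := (pow_le_pow_left₀ zero_le (nnnorm_sum_le Finset.univ a) 2).trans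
          sq_sum_le_card_mul_sum_sq
        simpa only [Finset.card_univ] using h'
      have h' := ENNReal.coe_le_coe.2 h
      push_cast at h'
      exact h'
    have hbound : ∀ n, ∫⁻ X, (‖g n X - c * ∑ σ : Equiv.Perm (Fin N), f₂ (X ∘ σ)‖₊ : ℝ≥0∞) ^ 2 ≤
        ((‖c‖₊ : ℝ≥0∞)) ^ 2 * (Fintype.card (Equiv.Perm (Fin N)) : ℝ≥0∞) *
          (Fintype.card (Equiv.Perm (Fin N)) : ℝ≥0∞) * ∫⁻ X, (‖g n X - f₂ X‖₊ : ℝ≥0∞) ^ 2 := by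
      intro n
      have hid : ∀ X, g n X - c * ∑ σ : Equiv.Perm (Fin N), f₂ (X ∘ σ) =
          c * ∑ σ : Equiv.Perm (Fin N), (g n (X ∘ σ) - f₂ (X ∘ σ)) := by
        intro X
        rw [Finset.sum_sub_distrib, mul_sub]
        congr 1
        simp_rw [hgσ n]
        rw [Finset.sum_const, Finset.card_univ, nsmul_eq_mul, ← mul_assoc, hcard, one_mul]
      have hptw : ∀ X, (‖g n X - c * ∑ σ : Equiv.Perm (Fin N), f₂ (X ∘ σ)‖₊ : ℝ≥0∞) ^ 2 ≤
          ((‖c‖₊ : ℝ≥0∞)) ^ 2 * ((Fintype.card (Equiv.Perm (Fin N)) : ℝ≥0∞) *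
            ∑ σ : Equiv.Perm (Fin N), (‖g n (X ∘ σ) - f₂ (X ∘ σ)‖₊ : ℝ≥0∞) ^ 2) := by
        intro X
        rw [hid X, nnnorm_mul, ENNReal.coe_mul, mul_pow]
        gcongr
        exact hcs fun σ => g n (X ∘ σ) - f₂ (X ∘ σ)
      have hint : ∀ σ : Equiv.Perm (Fin N),
          ∫⁻ X, (‖g n (X ∘ σ) - f₂ (X ∘ σ)‖₊ : ℝ≥0∞) ^ 2 = ∫⁻ X, (‖g n X - f₂ X‖₊ : ℝ≥0∞) ^ 2 :=
        fun σ => lintegral_comp_perm σ (fun X => (‖g n X - f₂ X‖₊ : ℝ≥0∞) ^ 2)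
      have hmeas : ∀ σ : Equiv.Perm (Fin N),
          Measurable fun X => (‖g n (X ∘ σ) - f₂ (X ∘ σ)‖₊ : ℝ≥0∞) ^ 2 := fun σ =>
        (((hgm n).comp (hperm σ)).sub (hf₂m.comp (hperm σ))).nnnorm.coe_nnreal_ennreal.pow_const 2
      calc ∫⁻ X, (‖g n X - c * ∑ σ : Equiv.Perm (Fin N), f₂ (X ∘ σ)‖₊ : ℝ≥0∞) ^ 2
          ≤ ∫⁻ X, ((‖c‖₊ : ℝ≥0∞)) ^ 2 * ((Fintype.card (Equiv.Perm (Fin N)) : ℝ≥0∞) *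
              ∑ σ : Equiv.Perm (Fin N), (‖g n (X ∘ σ) - f₂ (X ∘ σ)‖₊ : ℝ≥0∞) ^ 2) :=
            lintegral_mono hptw
        _ = ((‖c‖₊ : ℝ≥0∞)) ^ 2 * ((Fintype.card (Equiv.Perm (Fin N)) : ℝ≥0∞) *
              ∑ σ : Equiv.Perm (Fin N), ∫⁻ X, (‖g n (X ∘ σ) - f₂ (X ∘ σ)‖₊ : ℝ≥0∞) ^ 2) := by
            rw [lintegral_const_mul' _ _ (by finiteness), lintegral_const_mul' _ _ (by finiteness),
              lintegral_finsetSum _ fun σ _ => hmeas σ]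
        _ = ((‖c‖₊ : ℝ≥0∞)) ^ 2 * (Fintype.card (Equiv.Perm (Fin N)) : ℝ≥0∞) *
              (Fintype.card (Equiv.Perm (Fin N)) : ℝ≥0∞) * ∫⁻ X, (‖g n X - f₂ X‖₊ : ℝ≥0∞) ^ 2 := by
            rw [Finset.sum_congr rfl fun σ _ => hint σ, Finset.sum_const, Finset.card_univ,
              nsmul_eq_mul]
            ring
    refine tendsto_of_tendsto_of_tendsto_of_le_of_le tendsto_const_nhds ?_ (fun n => zero_le) hbound
    have h := ENNReal.Tendsto.const_mul hlim₂ (Or.inr hC)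
    rw [mul_zero] at h
    exact h

/-! ### The stub -/

/-- **Stub `stub_compactness` of line `Sketch` — compactness of bounded-energy sequences of trial
states (Rellich–Kondrachov on the box).** For every `v`, every sequence of admissible trial states
with energies bounded by a finite `E` has a subsequence converging in `L²((ℝ³)^N)` to a Borel
measurable, Dirichlet, Bose-symmetric function: `∫|∇Φₙ|² ≤ E` and `‖DΦₙ‖² ≤ 3N|∇Φₙ|²` give a
uniform `W^{1,2}` bound (`eLpNorm_fderiv_le`), `‖Φₙ‖₂ = 1`, supports in the compact closed box;
the tree's `C¹` Rellich core
`Literature.Analysis.FunctionSpaces.exists_subseq_tendsto_eLpNorm_of_contDiff` extracts an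
`L²`-convergent subsequence, and `exists_symm_limit` supplies the pointwise Dirichlet, symmetric,
measurable representative of the limit. [cite: ReedSimonIV1978, Thm XIII.64] -/
theorem stub_compactness :
    ∀ (N : ℕ) (L : ℝ) (v : ℝ → ℝ≥0∞) (E : ℝ≥0∞) (Φ : ℕ → TrialState N L), E ≠ ⊤ →
      (∀ n, energy v (Φ n) ≤ E) →
      ∃ (Ψ : Config N → ℂ) (φ : ℕ → ℕ), StrictMono φ ∧ Measurable Ψ ∧
        (∀ X, X ∉ boxN N L → Ψ X = 0) ∧
        (∀ (σ : Equiv.Perm (Fin N)) (X : Config N), Ψ (X ∘ σ) = Ψ X) ∧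
        TendstoL2 (fun n => Φ (φ n)) Ψ := by
  intro N L v E Φ hE hΦE
  haveI : (volume : Measure (Config N)).IsAddHaarMeasure :=
    show Measure.IsAddHaarMeasure (Measure.pi fun _ : Fin N => (volume : Measure Space)) from
      Measure.pi.isAddHaarMeasure _
  -- uniform bounds and supports
  have hA : ∀ n, eLpNorm (Φ n).ψ 2 volume ≤ 1 := fun n => by
    rw [eLpNorm_two_eq_rpow, (Φ n).norm_eq, ENNReal.one_rpow]
  have hBtop : ((3 * N : ℝ≥0∞) * E) ^ (1 / 2 : ℝ) ≠ ⊤ :=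
    ENNReal.rpow_ne_top_of_nonneg (by norm_num)
      (ENNReal.mul_ne_top (ENNReal.mul_ne_top (by norm_num) (ENNReal.natCast_ne_top N)) hE)
  have hK : IsCompact (closure (boxN N L)) := (isBounded_boxN N L).isCompact_closure
  have hsupp : ∀ n, tsupport (Φ n).ψ ⊆ closure (boxN N L) := fun n =>
    closure_mono fun X hX => by_contra fun h => hX ((Φ n).eq_zero X h)
  -- Rellich–Kondrachov
  obtain ⟨f, φ, hφ, hf, hlim⟩ :=
    Literature.Analysis.FunctionSpaces.exists_subseq_tendsto_eLpNorm_of_contDiff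
      (volume : Measure (Config N)) (p := 2) (by norm_num) hK (fun n => (Φ n).ψ)
      (fun n => (Φ n).contDiff) hsupp ENNReal.one_ne_top hBtop hA
      (fun n => eLpNorm_fderiv_le v (Φ n) (hΦE n))
  -- `∫ |Φ_{φ n} - f|² → 0`
  have hT : Tendsto (fun n => ∫⁻ X, (‖(Φ (φ n)).ψ X - f X‖₊ : ℝ≥0∞) ^ 2) atTop (𝓝 0) := by
    have h' : Tendsto (fun n => (eLpNorm ((Φ (φ n)).ψ - f) 2 volume) ^ (2 : ℝ)) atTop
        (𝓝 ((0 : ℝ≥0∞) ^ (2 : ℝ))) :=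
      (ENNReal.continuous_rpow_const.tendsto 0).comp hlim
    rw [ENNReal.zero_rpow_of_pos (by norm_num)] at h'
    refine h'.congr fun n => ?_
    rw [eLpNorm_two_eq_rpow, ← ENNReal.rpow_mul]
    norm_num
  -- the representative
  obtain ⟨Ψ, hΨm, hΨ0, hΨσ, hΨlim⟩ := exists_symm_limit L (fun n => (Φ (φ n)).ψ)
    (fun n => (Φ (φ n)).contDiff.continuous.measurable) (fun n => (Φ (φ n)).eq_zero)
    (fun n => (Φ (φ n)).symm) hf.1 hT
  exact ⟨Ψ, φ, hφ, hΨm, hΨ0, hΨσ, hΨlim⟩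

end Summit.AtomisticToContinuum.BoseEinsteinCondensation.Theorems.GroundStateRigidity

end
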